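import Literature.NumberTheory.EllipticCurves.CuspFormsGamma1EisensteinDivision
import Literature.LinearAlgebra.BaseChange.RationalRelations
import HarnessLib

/-!
# Deligne–Serre 1974, Prop. 2.7 (2.7.2): reduction of the weight by `E₄` and `E₆`

The named fact `DeligneSerre1974_span_integralLattice1 N k`
(`Literature.NumberTheory.EllipticCurves.NewformGaloisRepIntegralityProofs`) is Deligne–Serre's
(2.7.2): for `k ≥ 1` the `ℤ`-module `L = integralLattice1 N k ⊆ S_k(Γ₁(N))` of cusp forms all of
whose diamond twists `⟨d⟩ f` have `q`-expansion in `ℤ⟦q⟧` spans `S_k(Γ₁(N))` over `ℂ`.  It is the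
only unproved input of `IsNewform1.exists_map_eq_heckePolynomial` (integrality of the Hecke
polynomial of a newform, `IsNewform1.exists_map_eq_heckePolynomial_of_span_integralLattice1`) and
of the rest of Prop. 2.7 (`DeligneSerreProp27Proofs`), and through them of the weight-one theorem
of Deligne–Serre.  Its printed proof uses the modular stack of `Γ₁(N)` ((2.6.1), Deligne–Rapoport)
and the Tate curve; Deligne–Serre add (Rem. 2.8) that for `k ≥ 2` one may instead use Shimura 1971,
Thm. 3.52, *"et ramener le poids 1 au poids 13 par multiplication par `Δ`"*.

This file proves, inside the tree, a sharper form of that remark which needs no input in weight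
one at all:

* `DeligneSerre1974_span_integralLattice1.of_weight_add` — **(2.7.2) in weights `k + 4` and
  `k + 6` implies (2.7.2) in weight `k`** (every `k`, every `N ≥ 1`);
* `DeligneSerre1974_span_integralLattice1.of_forall_le` — hence (2.7.2) in all weights `≥ K₀`
  (any `K₀`, e.g. `K₀ = 2`, the range of Shimura's Thm. 3.52: `of_two_le`) implies (2.7.2) in
  every weight, in particular in weight one (`weight_one_of_five_seven`);
* `IsNewform1.exists_map_eq_heckePolynomial_of_span_integralLattice1_of_le` — so the Hecke
  polynomial of a newform of *any* weight (weight one included) is integral as soon as (2.7.2)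
  holds in all sufficiently large weights.

## The argument

Multiplication by the level-one Eisenstein series `E₄`, `E₆` (integral `q`-expansions with
constant term `1`, Mathlib `EisensteinSeries.E_qExpansion_coeff`) embeds `S_k(Γ₁(N))` into
`S_{k+4}(Γ₁(N)) × S_{k+6}(Γ₁(N))`, `f ↦ (E₄ f, E₆ f)`, with image the pairs `(g, h)` such that
`E₆ g = E₄ h`: given such a pair, `f = g/E₄ = h/E₆` is holomorphic on `ℍ` because `E₄` and `E₆`
have no common zero (`1728 Δ = E₄³ - E₆²`; the tree's division lemma
`exists_eq_E6_mul_of_E4_mul_eq` of `ModularFormsGamma0FreeModule`), and is cuspidal because `h`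
is and `E₆ → 1` at `i∞` (`exists_of_E₆_mul_eq_E₄_mul` of `CuspFormsGamma1EisensteinDivision`,
which collects the lemmas used here).  The condition `E₆ g = E₄ h` is a system
of linear equations on the coordinates of `(g, h)` in the lattices `L_{k+4}`, `L_{k+6}` whose
coefficients — Fourier coefficients of `gᵢ E₆`, `hⱼ E₄` for lattice vectors `gᵢ`, `hⱼ` — are
integers; a complex solution of a rational linear system is a complex combination of rational
solutions (`Literature.LinearAlgebra.BaseChange.exists_algebraMap_coords`: expand the coordinates
on a `ℚ`-basis of their `ℚ`-span); a rational solution gives `f` with `D f ∈ L_k` for a common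
denominator `D`, because
`⟨d⟩ (D f) · E₄ = ⟨d⟩ (D E₄ f) ∈ L_{k+4}` (diamond operators are slashes by elements of
`Γ₀(N) ≤ SL₂(ℤ)`, which fix `E₄`: `diamondOp_mulModularForm_ofLevelOne`) and `E₄` is a unit of
`ℤ⟦q⟧` (`exists_map_eq_of_map_mul_eq`).  Hence `f ∈ span_ℂ L_k`.

The same argument with `Δ` alone (Deligne–Serre's Rem. 2.8) only bounds denominators; using the
two forms `E₄`, `E₆` without common zero also transfers the spanning (rationality) statement, so
that weight one is reduced to weights `5` and `7` with no appeal to the modular stack.  (Dividing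
by Eisenstein series to reach weight one is the standard device of the computational literature
on weight-one forms; here it is used for the rational structure.)

## What is not here

No case of (2.7.2) itself is discharged: for `k ≥ 2` it remains the named fact
`DeligneSerre1974_span_integralLattice1` (Shimura 1971, Thm. 3.52 / Deligne–Serre (2.6.1)), whose
proofs need the rational structure on `S_k(Γ₁(N))` coming from the modular curve over `ℚ`, which
neither Mathlib nor the tree has.

## References

* P. Deligne, J.-P. Serre, *Formes modulaires de poids 1*, Ann. Sci. ÉNS (4) 7 (1974), 507–530,
  Prop. 2.7 and Rem. 2.8 (p. 512).
* G. Shimura, *Introduction to the arithmetic theory of automorphic functions*, Publ. Math. Soc.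
  Japan 11 (1971), Thm. 3.52.
* F. Diamond, J. Shurman, *A first course in modular forms*, GTM 228 (2005), §1.1–1.2 (`E₄`, `E₆`,
  `Δ`), Thm. 6.5.1.
-/

noncomputable section

open scoped MatrixGroups ModularForm
open CongruenceSubgroup UpperHalfPlane ModularForm

namespace Literature.NumberTheory.EllipticCurves.ModularForms

/-! ### The weight reduction -/

section Main

variable {N : ℕ} [NeZero N] {k : ℤ}

/-- **Weight reduction for Deligne–Serre 1974, (2.7.2).**  If Deligne–Serre's integral lattices
of weights `k + 4` and `k + 6` span `S_{k+4}(Γ₁(N))` and `S_{k+6}(Γ₁(N))` over `ℂ`, then the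
integral lattice of weight `k` spans `S_k(Γ₁(N))` (all `N ≥ 1`, all `k`; vacuous for `k ≤ 0`).
Proof: `f ↦ (E₄ f, E₆ f)` identifies `S_k` with the pairs `(g, h)`, `E₆ g = E₄ h`
(`exists_of_E₆_mul_eq_E₄_mul`); this is a linear system with integer coefficients on the lattice
coordinates of `(g, h)`, so its complex solutions are spanned by rational ones
(`exists_algebraMap_coords`), and a rational solution `g = E₄ f` gives `D f ∈ L_k` since
`⟨d⟩(D f) E₄ = ⟨d⟩(D g) ∈ L_{k+4}` and `E₄⁻¹ ∈ ℤ⟦q⟧`.  A two-multiplier form of Deligne–Serre's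
Rem. 2.8 (multiplication by `Δ`, which reduces bounded denominators in weight `1` to weight `13`);
with `E₄`, `E₆` (no common zero) the spanning statement itself descends. [folklore] -/
theorem DeligneSerre1974_span_integralLattice1.of_weight_add
    (h4 : DeligneSerre1974_span_integralLattice1 N (k + 4))
    (h6 : DeligneSerre1974_span_integralLattice1 N (k + 6)) :
    DeligneSerre1974_span_integralLattice1 N k := by
  classical
  intro hk
  obtain ⟨P₄, hP₄1, hP₄⟩ := exists_int_map_eq_qExpansion_E₄
  obtain ⟨P₆, -, hP₆⟩ := exists_int_map_eq_qExpansion_E₆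
  have hΓ := HeckeTGamma1.one_mem_strictPeriods_Gamma1 N
  rw [eq_top_iff]
  rintro f -
  -- Step 1: `f E₄`, `f E₆` are complex combinations of lattice forms of weights `k + 4`, `k + 6`
  obtain ⟨n₄, α, g, hg⟩ := Submodule.mem_span_set'.mp
    (show f.mulModularForm (ofLevelOne (Gamma1 N) E₄) ∈
        Submodule.span ℂ (integralLattice1 N (k + 4) : Set _) by
      rw [h4 (by omega)]; trivial)
  obtain ⟨n₆, β, h, hh⟩ := Submodule.mem_span_set'.mp
    (show f.mulModularForm (ofLevelOne (Gamma1 N) E₆) ∈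
        Submodule.span ℂ (integralLattice1 N (k + 6) : Set _) by
      rw [h6 (by omega)]; trivial)
  -- the integer tables `A i n = aₙ(gᵢ E₆)`, `B j n = aₙ(hⱼ E₄)`
  have hA' : ∀ (i : Fin n₄) (n : ℕ), ∃ z : ℤ,
      (z : ℂ) = cuspCoeff
        ((g i : CuspForm (Gamma1 N) (k + 4)).mulModularForm (ofLevelOne (Gamma1 N) E₆)) n :=
    fun i ↦ exists_int_eq_cuspCoeff_mulModularForm hP₆
      (exists_int_eq_cuspCoeff_of_mem_integralLattice1 (g i).2)
  have hB' : ∀ (j : Fin n₆) (n : ℕ), ∃ z : ℤ,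
      (z : ℂ) = cuspCoeff
        ((h j : CuspForm (Gamma1 N) (k + 6)).mulModularForm (ofLevelOne (Gamma1 N) E₄)) n :=
    fun j ↦ exists_int_eq_cuspCoeff_mulModularForm hP₄
      (exists_int_eq_cuspCoeff_of_mem_integralLattice1 (h j).2)
  choose A hA using hA'
  choose B hB using hB'
  -- Step 2: rational coordinates `q` for the coefficient vector `(α, β)` on `c : Fin t → ℂ`
  obtain ⟨t, c, q, hγ, hrel⟩ :
      ∃ (t : ℕ) (c : Fin t → ℂ) (q : Fin n₄ ⊕ Fin n₆ → Fin t → ℚ),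
        (∀ i, Sum.elim α β i = ∑ l, (q i l : ℂ) * c l) ∧
        ∀ r : Fin n₄ ⊕ Fin n₆ → ℚ, ∑ i, (r i : ℂ) * Sum.elim α β i = 0 →
          ∀ l, ∑ i, r i * q i l = 0 := by
    simpa only [eq_ratCast] using
      Literature.LinearAlgebra.BaseChange.exists_algebraMap_coords ℚ (Sum.elim α β)
  -- Step 3: the integer relations
  -- `∑ᵢ αᵢ aₙ(gᵢ E₆) - ∑ⱼ βⱼ aₙ(hⱼ E₄) = aₙ(f E₄ E₆) - aₙ(f E₆ E₄) = 0`
  have hlin : ∀ {w w' : ℤ} (E : ModularForm (Gamma1 N) w') {ι : Type} [Fintype ι] (a : ι → ℂ)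
      (x : ι → CuspForm (Gamma1 N) w) (n : ℕ),
      cuspCoeff ((∑ i, a i • x i).mulModularForm E) n =
        ∑ i, a i * cuspCoeff ((x i).mulModularForm E) n := by
    intro w w' E ι _ a x n
    rw [sum_smul_mulModularForm, ← cuspCoeffₗ_apply hΓ, map_sum]
    simp only [map_smul, cuspCoeffₗ_apply, smul_eq_mul]
  have hrelation : ∀ n : ℕ,
      ∑ x, ((Sum.elim (fun i ↦ (A i n : ℚ)) (fun j ↦ -(B j n : ℚ)) x : ℚ) : ℂ) *
        Sum.elim α β x = 0 := by
    intro n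
    have e1 : cuspCoeff ((f.mulModularForm (ofLevelOne (Gamma1 N) E₄)).mulModularForm
          (ofLevelOne (Gamma1 N) E₆)) n =
        ∑ i, α i * cuspCoeff ((g i : CuspForm (Gamma1 N) (k + 4)).mulModularForm
          (ofLevelOne (Gamma1 N) E₆)) n := by
      rw [← hg, hlin]
    have e2 : cuspCoeff ((f.mulModularForm (ofLevelOne (Gamma1 N) E₆)).mulModularForm
          (ofLevelOne (Gamma1 N) E₄)) n =
        ∑ j, β j * cuspCoeff ((h j : CuspForm (Gamma1 N) (k + 6)).mulModularForm
          (ofLevelOne (Gamma1 N) E₄)) n := by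
      rw [← hh, hlin]
    have e3 : cuspCoeff ((f.mulModularForm (ofLevelOne (Gamma1 N) E₄)).mulModularForm
          (ofLevelOne (Gamma1 N) E₆)) n =
        cuspCoeff ((f.mulModularForm (ofLevelOne (Gamma1 N) E₆)).mulModularForm
          (ofLevelOne (Gamma1 N) E₄)) n := by
      change PowerSeries.coeff n (qExpansion 1
          ⇑((f.mulModularForm (ofLevelOne (Gamma1 N) E₄)).mulModularForm
            (ofLevelOne (Gamma1 N) E₆))) =
        PowerSeries.coeff n (qExpansion 1
          ⇑((f.mulModularForm (ofLevelOne (Gamma1 N) E₆)).mulModularForm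
            (ofLevelOne (Gamma1 N) E₄)))
      rw [show (⇑((f.mulModularForm (ofLevelOne (Gamma1 N) E₄)).mulModularForm
            (ofLevelOne (Gamma1 N) E₆)) : ℍ → ℂ) =
          ⇑((f.mulModularForm (ofLevelOne (Gamma1 N) E₆)).mulModularForm
            (ofLevelOne (Gamma1 N) E₄)) by
        simp only [CuspForm.coe_mulModularForm]; ring]
    rw [Fintype.sum_sum_type]
    simp only [Sum.elim_inl, Sum.elim_inr, Rat.cast_intCast, Rat.cast_neg, hA, hB, neg_mul,
      Finset.sum_neg_distrib]
    rw [add_neg_eq_zero]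
    simp only [mul_comm _ (α _), mul_comm _ (β _)]
    rw [← e1, ← e2, e3]
  -- Step 4: the rational combinations `G l = ∑ᵢ q_{il} gᵢ`, `H l = ∑ⱼ q_{jl} hⱼ` satisfy
  -- `E₆ (G l) = E₄ (H l)` (compare `q`-expansions)
  set G : Fin t → CuspForm (Gamma1 N) (k + 4) := fun l ↦
    ∑ i, ((q (Sum.inl i) l : ℚ) : ℂ) • (g i : CuspForm (Gamma1 N) (k + 4)) with hGdef
  set H : Fin t → CuspForm (Gamma1 N) (k + 6) := fun l ↦
    ∑ j, ((q (Sum.inr j) l : ℚ) : ℂ) • (h j : CuspForm (Gamma1 N) (k + 6)) with hHdef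
  have hGH : ∀ l, (⇑E₆ : ℍ → ℂ) * ⇑(G l) = ⇑E₄ * ⇑(H l) := by
    intro l
    have hcoeff : ∀ n, cuspCoeff ((G l).mulModularForm (ofLevelOne (Gamma1 N) E₆)) n =
        cuspCoeff (CuspForm.mcast (show k + 6 + 4 = k + 4 + 6 by ring)
          ((H l).mulModularForm (ofLevelOne (Gamma1 N) E₄))) n := by
      intro n
      have hq := hrel _ (hrelation n) l
      rw [Fintype.sum_sum_type] at hq
      simp only [Sum.elim_inl, Sum.elim_inr, neg_mul, Finset.sum_neg_distrib] at hq
      rw [add_neg_eq_zero] at hq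
      have hq' := congrArg (fun r : ℚ ↦ (r : ℂ)) hq
      simp only [Rat.cast_sum, Rat.cast_mul, Rat.cast_intCast, hA, hB] at hq'
      have eG : cuspCoeff ((G l).mulModularForm (ofLevelOne (Gamma1 N) E₆)) n =
          ∑ i, ((q (Sum.inl i) l : ℚ) : ℂ) *
            cuspCoeff ((g i : CuspForm (Gamma1 N) (k + 4)).mulModularForm
              (ofLevelOne (Gamma1 N) E₆)) n := by
        rw [hGdef, hlin]
      have eH : cuspCoeff (CuspForm.mcast (show k + 6 + 4 = k + 4 + 6 by ring)
          ((H l).mulModularForm (ofLevelOne (Gamma1 N) E₄))) n =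
          ∑ j, ((q (Sum.inr j) l : ℚ) : ℂ) *
            cuspCoeff ((h j : CuspForm (Gamma1 N) (k + 6)).mulModularForm
              (ofLevelOne (Gamma1 N) E₄)) n := by
        change cuspCoeff ((H l).mulModularForm (ofLevelOne (Gamma1 N) E₄)) n = _
        rw [hHdef, hlin]
      rw [eG, eH]
      simpa only [mul_comm] using hq'
    have := congrArg (fun Φ : CuspForm (Gamma1 N) (k + 4 + 6) ↦ (⇑Φ : ℍ → ℂ))
      (eq_of_forall_cuspCoeff_eq hΓ hcoeff)
    change (⇑((G l).mulModularForm (ofLevelOne (Gamma1 N) E₆)) : ℍ → ℂ) =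
      ⇑((H l).mulModularForm (ofLevelOne (Gamma1 N) E₄)) at this
    rw [CuspForm.coe_mulModularForm, CuspForm.coe_mulModularForm, coe_ofLevelOne,
      coe_ofLevelOne] at this
    rw [mul_comm, this, mul_comm]
  -- Step 5: divide: `G l = E₄ F l`, `H l = E₆ F l` with `F l ∈ S_k(Γ₁(N))`
  choose F hF4 hF6 using fun l ↦ exists_of_E₆_mul_eq_E₄_mul (G l) (H l) (hGH l)
  -- Step 6: `f = ∑ₗ cₗ Fₗ` (multiply by `E₄`)
  have hfsum : f = ∑ l, c l • F l := by
    apply DFunLike.coe_injective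
    refine E4_mul_left_cancel f.holo'.continuous (∑ l, c l • F l).holo'.continuous ?_
    have e1 : (⇑E₄ : ℍ → ℂ) * ⇑f = ⇑(f.mulModularForm (ofLevelOne (Gamma1 N) E₄)) := by
      rw [CuspForm.coe_mulModularForm, coe_ofLevelOne, mul_comm]
    have e2 : (⇑E₄ : ℍ → ℂ) * ⇑(∑ l, c l • F l) =
        ⇑((∑ l, c l • F l).mulModularForm (ofLevelOne (Gamma1 N) E₄)) := by
      rw [CuspForm.coe_mulModularForm, coe_ofLevelOne, mul_comm]
    rw [e1, e2, ← hg, sum_smul_mulModularForm]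
    congr 1
    simp only [hF4]
    have hα : ∀ i, α i = ∑ l, (q (Sum.inl i) l : ℂ) * c l := fun i ↦ hγ (Sum.inl i)
    simp only [hGdef, Finset.smul_sum, smul_smul, hα, Finset.sum_smul]
    rw [Finset.sum_comm]
    exact Finset.sum_congr rfl fun i _ ↦ Finset.sum_congr rfl fun l _ ↦ by rw [mul_comm]
  -- Step 7: each `F l` lies in `ℚ L_k ⊆ span_ℂ L_k`: clear denominators and invert `E₄` in `ℤ⟦q⟧`
  have hFmem : ∀ l,
      F l ∈ Submodule.span ℂ (integralLattice1 N k : Set (CuspForm (Gamma1 N) k)) := by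
    intro l
    set D : ℕ := ∏ i, (q (Sum.inl i) l).den with hD
    have hD0 : (D : ℂ) ≠ 0 := by
      rw [Nat.cast_ne_zero, hD]
      exact Finset.prod_ne_zero_iff.mpr fun i _ ↦ (q (Sum.inl i) l).den_ne_zero
    have hDq : ∀ i, ∃ z : ℤ, (z : ℚ) = D * q (Sum.inl i) l := by
      intro i
      obtain ⟨m, hm⟩ : (q (Sum.inl i) l).den ∣ D := Finset.dvd_prod_of_mem _ (Finset.mem_univ i)
      refine ⟨m * (q (Sum.inl i) l).num, ?_⟩
      rw [hm]
      push_cast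
      rw [← Rat.mul_den_eq_num (q (Sum.inl i) l)]
      ring
    choose z hz using hDq
    have hDG : (D : ℂ) • G l ∈ integralLattice1 N (k + 4) := by
      have : (D : ℂ) • G l = ∑ i, (z i : ℤ) • (g i : CuspForm (Gamma1 N) (k + 4)) := by
        rw [hGdef]
        dsimp only
        rw [Finset.smul_sum]
        refine Finset.sum_congr rfl fun i _ ↦ ?_
        rw [smul_smul, ← Int.cast_smul_eq_zsmul ℂ, ← Rat.cast_intCast (α := ℂ), hz i]
        push_cast
        rfl
      rw [this]
      exact Submodule.sum_mem _ fun i _ ↦ Submodule.smul_mem _ _ (g i).2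
    have hDF : (D : ℂ) • F l ∈ integralLattice1 N k := by
      rw [mem_integralLattice1]
      intro d n
      have hmem : diamondOp N (k + 4) (d : ZMod N) ((D : ℂ) • G l) ∈ integralLattice1 N (k + 4) :=
        diamondOp_mem_integralLattice1 hDG d
      have hprod :
          (diamondOp N k (d : ZMod N) ((D : ℂ) • F l)).mulModularForm (ofLevelOne (Gamma1 N) E₄) =
            diamondOp N (k + 4) (d : ZMod N) ((D : ℂ) • G l) := by
        rw [← diamondOp_mulModularForm_ofLevelOne, smul_mulModularForm, hF4]
      obtain ⟨R₀, hR₀⟩ := exists_map_eq_of_forall_exists_int_eq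
        (Q := qExpansion 1 ⇑(diamondOp N (k + 4) (d : ZMod N) ((D : ℂ) • G l)))
        (fun m ↦ exists_int_eq_cuspCoeff_of_mem_integralLattice1 hmem m)
      have hmul : P₄.map (Int.castRingHom ℂ) *
          qExpansion 1 ⇑(diamondOp N k (d : ZMod N) ((D : ℂ) • F l)) =
            R₀.map (Int.castRingHom ℂ) := by
        rw [hR₀, ← hprod, qExpansion_mulModularForm_ofLevelOne, hP₄, mul_comm]
      obtain ⟨Q₀, hQ₀⟩ := exists_map_eq_of_map_mul_eq hP₄1 hmul
      refine ⟨PowerSeries.coeff n Q₀, ?_⟩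
      change _ = PowerSeries.coeff n (qExpansion 1 ⇑(diamondOp N k (d : ZMod N) ((D : ℂ) • F l)))
      rw [← hQ₀, PowerSeries.coeff_map, eq_intCast]
    have : F l = (D : ℂ)⁻¹ • ((D : ℂ) • F l) := by rw [smul_smul, inv_mul_cancel₀ hD0, one_smul]
    rw [this]
    exact Submodule.smul_mem _ _ (Submodule.subset_span hDF)
  rw [hfsum]
  exact Submodule.sum_mem _ fun l _ ↦ Submodule.smul_mem _ _ (hFmem l)

/-- **Weight one from weights five and seven**: (2.7.2) for `S_5(Γ₁(N))` and `S_7(Γ₁(N))` implies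
(2.7.2) for `S_1(Γ₁(N))` — the case of `of_weight_add` relevant to Deligne–Serre's weight-one
theorem (their Rem. 2.8 reduces weight `1` to weight `13` by `Δ`). [folklore] -/
theorem DeligneSerre1974_span_integralLattice1.weight_one_of_five_seven
    (h5 : DeligneSerre1974_span_integralLattice1 N 5)
    (h7 : DeligneSerre1974_span_integralLattice1 N 7) :
    DeligneSerre1974_span_integralLattice1 N 1 :=
  DeligneSerre1974_span_integralLattice1.of_weight_add (k := 1) h5 h7

/-- **(2.7.2) in all large weights implies (2.7.2) in every weight**: if the integral lattice
spans `S_{k'}(Γ₁(N))` for every `k' ≥ K₀`, then it spans `S_k(Γ₁(N))` for every `k` (descending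
induction with `of_weight_add`, the weights `k + 4`, `k + 6` being closer to `K₀`). [folklore] -/
theorem DeligneSerre1974_span_integralLattice1.of_forall_le {K₀ : ℤ}
    (H : ∀ k', K₀ ≤ k' → DeligneSerre1974_span_integralLattice1 N k') (k : ℤ) :
    DeligneSerre1974_span_integralLattice1 N k := by
  suffices h : ∀ (m : ℕ) (k : ℤ), (K₀ - k).toNat ≤ m →
      DeligneSerre1974_span_integralLattice1 N k from h _ k le_rfl
  intro m
  induction m with
  | zero => exact fun k hk ↦ H k (by omega)
  | succ m ih =>
    intro k hk
    by_cases hK : K₀ ≤ k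
    · exact H k hK
    · exact DeligneSerre1974_span_integralLattice1.of_weight_add (ih (k + 4) (by omega))
        (ih (k + 6) (by omega))

/-- (2.7.2) in all weights `k ≥ 2` — the range in which Shimura 1971, Thm. 3.52 provides integral
bases of `S_k` (Deligne–Serre 1974, Rem. 2.8) — implies (2.7.2) in every weight, weight one
included. [folklore] -/
theorem DeligneSerre1974_span_integralLattice1.of_two_le
    (H : ∀ k', 2 ≤ k' → DeligneSerre1974_span_integralLattice1 N k') (k : ℤ) :
    DeligneSerre1974_span_integralLattice1 N k :=
  DeligneSerre1974_span_integralLattice1.of_forall_le H k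

/-- **The Hecke polynomial of a newform on `Γ₁(N)` of any weight — weight one included — is
integral, granted Deligne–Serre's (2.7.2) in all sufficiently large weights** (any threshold `K₀`):
`IsNewform1.exists_map_eq_heckePolynomial_of_span_integralLattice1` composed with
`DeligneSerre1974_span_integralLattice1.of_forall_le`. [folklore] -/
theorem IsNewform1.exists_map_eq_heckePolynomial_of_span_integralLattice1_of_le {K₀ : ℤ}
    (H : ∀ k', K₀ ≤ k' → DeligneSerre1974_span_integralLattice1 N k')
    {f : CuspForm (Gamma1 N) k} : IsNewform1.exists_map_eq_heckePolynomial (f := f) :=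
  IsNewform1.exists_map_eq_heckePolynomial_of_span_integralLattice1
    (DeligneSerre1974_span_integralLattice1.of_forall_le H k)

end Main

end Literature.NumberTheory.EllipticCurves.ModularForms
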